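/- Copyright: the b2b-balaban cell (near-miss cell 7), T⁴-continuum fan-out, lineage t4-ne7b-p1 (node U5c COUNT
member).  Released under the licence of the surrounding project. -/
import Summits.QuantumFields.BalabanUV.T4Continuum.Support.HistoryBankingAnchors82
import Summits.QuantumFields.BalabanUV.T4Continuum.Support.HistoryBankingFlatJunction

/-!
# M5-2e (E3) — THE PER-LEVEL DEAD BOX ALONG A PEDIGREE: the three-way split YOUNG ∕ FRESH-DEAD ∕ OLD-DEAD of the births,
the cover of the maximal domain, the lagged thickened-footprint count, and the PER-STEP INEQUALITY
`V(m) ≤ Y(m) + 561^d·fresh(m) + Σ_{components x at t} (collar82 d + feed82 d·V_x(t)∕2^{m−t}) + 165^d·#recent births`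
(owner module of row NE7b, lineage `t4-ne7b-p1` gen 51; re-open object (α), ruling R-OWNER-51-1 «M5-2e COMMISSIONED»;
PRE-POSITIONING ONLY)

Summits-side support leaf of the T⁴-continuum cell (rung (B)+1 on a FINITE torus only; NOT infinite volume, NOT the
mass gap, NOT the Clay statement; NOT a proof of the spine estimate NE7b — the cell's OWN estimate, NOT PRINTED, NOT
PROVED).  [folklore] finite combinatorics on `ℤᵈ` and real arithmetic over `HistoryAdmissible.PGen` ∕
`HistoryRealiseWeak.RealisesW`, A3a `HistoryBankingPedigreeMax.MDP`, A3b `HistoryBankingPedigreeLedger` (`compSum`,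
`youngVol`, `youngSet`, `deadAnchors`, `recent`, `deadAnchors_subset_closureIdx`), M5-1b `HistoryBankingFlatJunction.nb`,
the sibling E2 `HistoryBankingAnchors82` (`orbit_subset_box82_of_condI`, `card_thick82_closureIdx_le`, `collar82`,
`feed82`) and A1's `card_orbit_le_of_condI`; nothing printed is asserted, no `def … : Prop` fact of Bałaban's, no
cite-tagged hypothesis, zero `sorry`.  Three `def`s (`oldAnchors`, `freshSet`, `nfresh`) are recursive finite sets ∕
counts over the pedigree.  B16 = [Balaban1989LargeFieldII] pp. 384–387 under audit; locators only.

WHY (ruling R-OWNER-51-1 (3)).  A3b reads the maximal volume at step `m` as YOUNG images plus `561^d` per distinct DEAD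
anchor (A1's all-steps radius-`280` box).  THIS FILE re-runs that sentence with THREE classes of births at `m`: YOUNG (no
condition (i) on the own orbit up to `m` — A3b's `youngVol`∕`youngSet`, unchanged), FRESH-DEAD (condition (i) met at some
index `≤ m − j_b` but at none `≤ m − j_b − 14`: the orbit has `≤ 561^d` cubes by A1 — paid PER BIRTH, `nfresh` counts them;
E4 shows each birth is fresh at `≤ 14` levels), OLD-DEAD (condition (i) met at an index `i` with `i + 14 ≤ m − j_b`: the
orbit lies in the radius-`82` box about the birth's anchor at scale `m` — E2).  §1 `oldAnchors` ∕ `freshSet` ∕ `nfresh`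
and `oldAnchors ⊆ deadAnchors` (so A3b's ANCHOR TRANSPORT applies verbatim); §2 the COVER
`MDP P m ⊆ youngSet P m ∪ freshSet P m ∪ ⋃_{a ∈ oldAnchors P m} box a 82` and the count
`#MDP P m ≤ youngVol P m + 561^d·nfresh P m + #(⋃_{a ∈ oldAnchors P m} box a 82)`; §3 THE LAGGED THICKENED COUNT
`#(⋃_{a ∈ oldAnchors P m} box a 82) ≤ Σ_{components x at t} (collar82 d + feed82 d·#MDP_x(t)∕2^{m−t}) + 165^d·recent P t m`
(`t + 1 ≤ m`; one component: the old anchors lie in the lag-time footprint, whose `82`-thickening E2 counts by the union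
lemma; a birth after `t`: one radius-`82` box; a join after `t`: the partners); §4 **`perStep82`**.

WHAT IS *NOT* DONE HERE.  The step before the lag, the fresh-level exchange `Σ_m u_m·nfresh ≤ 14·Γ·bfee`, the summed ledger and its calibrated
form (E4 `HistoryBankingShrunkLedger82`), the witness plug (E5).  HONEST: index-model bookkeeping; NE7b NOT proved; spine
0∕9.  HONEST DEPENDENCY (cell): continuum YM on T⁴ ⇐ BetaPertH ∧ nine spine estimates (0∕9 proved); BetaPertH ⇐ (D1)
∧ (D4) ∧ CAP+tail; G-an2-4 gates asym, D1 and NE2∕3∕4.  This file changes none of it.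
-/

open Finset
open Literature.MathematicalPhysics.QuantumFieldTheory.Balaban1983to89
open Literature.MathematicalPhysics.QuantumFieldTheory.Balaban1983to89.B13ScaleTransfer
open Literature.MathematicalPhysics.QuantumFieldTheory.Balaban1983to89.TreeLength
open Literature.MathematicalPhysics.QuantumFieldTheory.Balaban1983to89.B16SProfile
open Literature.MathematicalPhysics.QuantumFieldTheory.Balaban1983to89.B16MergeGeometry
open Literature.MathematicalPhysics.QuantumFieldTheory.Balaban1983to89.B16StoppingRule
open Literature.MathematicalPhysics.QuantumFieldTheory.Balaban1983to89.B16OverhangN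
open Summit.QuantumFields.BalabanUV.T4Continuum.HistoryAdmissible
open Summit.QuantumFields.BalabanUV.T4Continuum.HistoryRealise
open Summit.QuantumFields.BalabanUV.T4Continuum.HistoryRealiseCells
open Summit.QuantumFields.BalabanUV.T4Continuum.HistoryRealiseWeak
open Summit.QuantumFields.BalabanUV.T4Continuum.HistoryBankingAnchors
open Summit.QuantumFields.BalabanUV.T4Continuum.HistoryBankingAnchors82
open Summit.QuantumFields.BalabanUV.T4Continuum.HistoryBankingPedigreeMax
open Summit.QuantumFields.BalabanUV.T4Continuum.HistoryBankingPedigreeLedger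
open Summit.QuantumFields.BalabanUV.T4Continuum.HistoryBankingFlatJunction

namespace Summit.QuantumFields.BalabanUV.T4Continuum.HistoryBankingPedigreeLedger82

noncomputable section

open scoped Classical

variable {d : ℕ}

/-! ## §1 Old-dead anchors, fresh-dead images -/

section Split

variable (L : ℕ) (s : ℕ → ℕ)

/-- **THE OLD-DEAD ANCHORS AT `m`**: the re-blocked anchors `anchorAt · m` of the births that have happened and whose
orbit has met condition (i) at an index `i` with `i + 14 ≤ m − j` (coalesced anchors count once). [folklore] -/
def oldAnchors : PGen (Pt d × Finset (Pt d)) → ℕ → Finset (Pt d)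
  | .birth j cls zZ, m =>
      if j ≤ m ∧ ∃ i, i + 14 ≤ m - j ∧ CondI 100 (orbit L s j zZ.2 i) then {anchorAt L s (.birth j cls zZ) m} else ∅
  | .renew G _, m => oldAnchors G m
  | .join X Y _, m => oldAnchors X m ∪ oldAnchors Y m

/-- **THE FRESH-DEAD IMAGES AT `m`**: the orbits of the births that have happened, whose orbit has met condition (i) by
`m`, but at no index `i` with `i + 14 ≤ m − j`. [folklore] -/
def freshSet : PGen (Pt d × Finset (Pt d)) → ℕ → Finset (Pt d)
  | .birth j _ zZ, m =>
      if (j ≤ m ∧ ∃ i, i ≤ m - j ∧ CondI 100 (orbit L s j zZ.2 i)) ∧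
          ¬ (∃ i, i + 14 ≤ m - j ∧ CondI 100 (orbit L s j zZ.2 i)) then orbit L s j zZ.2 (m - j) else ∅
  | .renew G _, m => freshSet G m
  | .join X Y _, m => freshSet X m ∪ freshSet Y m

/-- **THE NUMBER OF FRESH-DEAD BIRTHS AT `m`**. [folklore] -/
def nfresh : PGen (Pt d × Finset (Pt d)) → ℕ → ℕ
  | .birth j _ zZ, m =>
      if (j ≤ m ∧ ∃ i, i ≤ m - j ∧ CondI 100 (orbit L s j zZ.2 i)) ∧
          ¬ (∃ i, i + 14 ≤ m - j ∧ CondI 100 (orbit L s j zZ.2 i)) then 1 else 0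
  | .renew G _, m => nfresh G m
  | .join X Y _, m => nfresh X m + nfresh Y m

variable {L s}

/-- a join's old anchors are the partners' [folklore] -/
@[simp] theorem oldAnchors_join (X Y : PGen (Pt d × Finset (Pt d))) (sj m : ℕ) :
    oldAnchors L s (.join X Y sj) m = oldAnchors L s X m ∪ oldAnchors L s Y m := rfl

/-- a join's fresh images are the partners' [folklore] -/
@[simp] theorem freshSet_join (X Y : PGen (Pt d × Finset (Pt d))) (sj m : ℕ) :
    freshSet L s (.join X Y sj) m = freshSet L s X m ∪ freshSet L s Y m := rfl

/-- a join's fresh count is the partners' [folklore] -/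
@[simp] theorem nfresh_join (X Y : PGen (Pt d × Finset (Pt d))) (sj m : ℕ) :
    nfresh L s (.join X Y sj) m = nfresh L s X m + nfresh L s Y m := rfl

/-- **OLD-DEAD IS DEAD**: `oldAnchors P m ⊆ deadAnchors P m` (an index `i` with `i + 14 ≤ m − j` is an index `≤ m − j`).
[folklore] -/
theorem oldAnchors_subset_deadAnchors : ∀ (P : PGen (Pt d × Finset (Pt d))) (m : ℕ),
    oldAnchors L s P m ⊆ deadAnchors L s P m
  | .birth j cls zZ, m => by
      unfold oldAnchors deadAnchors
      by_cases h : j ≤ m ∧ ∃ i, i + 14 ≤ m - j ∧ CondI 100 (orbit L s j zZ.2 i)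
      · obtain ⟨hj, i, hi, hI⟩ := h
        rw [if_pos ⟨hj, i, hi, hI⟩, if_pos ⟨hj, i, by omega, hI⟩]
      · rw [if_neg h]; exact Finset.empty_subset _
  | .renew G _, m => oldAnchors_subset_deadAnchors G m
  | .join X Y _, m => by
      rw [oldAnchors_join, deadAnchors_join]
      exact Finset.union_subset_union (oldAnchors_subset_deadAnchors X m) (oldAnchors_subset_deadAnchors Y m)

/-- **A FRESH-DEAD IMAGE HAS AT MOST `561^d` CUBES** (A1's all-steps dead box): along a flow with `L ≥ 2` and drop control
on every horizon, for a realised pedigree `#freshSet P m ≤ 561^d·nfresh P m`. [folklore] -/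
theorem card_freshSet_le (hL : 2 ≤ L) (hdrop : ∀ m, DropCtl s m) {R : ℕ → ℕ} :
    ∀ (P : PGen (Pt d × Finset (Pt d))) (Z : Finset (Pt d)), RealisesW L s R P Z → ∀ (m : ℕ),
      ((freshSet L s P m).card : ℝ) ≤ 561 ^ d * (nfresh L s P m : ℝ)
  | .birth j cls zZ, Z, hP, m => by
      obtain ⟨hZ, hc, -, -⟩ := hP
      have hcZ : zZ.1 ∈ zZ.2 := by rw [hZ]; exact hc
      unfold freshSet nfresh
      by_cases h : (j ≤ m ∧ ∃ i, i ≤ m - j ∧ CondI 100 (orbit L s j zZ.2 i)) ∧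
          ¬ (∃ i, i + 14 ≤ m - j ∧ CondI 100 (orbit L s j zZ.2 i))
      · rw [if_pos h, if_pos h]
        obtain ⟨⟨-, i, hi, hI⟩, -⟩ := h
        have := card_orbit_le_of_condI hL hdrop hcZ hI hi
        simp only [Nat.cast_one, mul_one]
        exact_mod_cast this
      · rw [if_neg h, if_neg h]; simp
  | .renew G h, Z, hP, m => by
      obtain ⟨ZG, hG, -⟩ := hP
      exact card_freshSet_le hL hdrop G ZG hG m
  | .join X Y sj, Z, hP, m => by
      obtain ⟨ZX, ZY, hX, hY, -⟩ := hP
      have h1 := card_freshSet_le hL hdrop X ZX hX m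
      have h2 := card_freshSet_le hL hdrop Y ZY hY m
      rw [freshSet_join, nfresh_join]
      have hu : ((freshSet L s X m ∪ freshSet L s Y m).card : ℝ) ≤ (freshSet L s X m).card + (freshSet L s Y m).card := by
        exact_mod_cast Finset.card_union_le _ _
      push_cast
      linarith

end Split

/-! ## §2 The cover of the maximal domain and the three-way count -/

section Cover

variable {L : ℕ} {s R : ℕ → ℕ}

/-- **THE COVER**: along a flow with `L ≥ 2` and drop control on every horizon, the maximal domain of a realised pedigree
at `m` lies in its young set, its fresh-dead images, and the radius-`82` boxes about its old-dead anchors (E2's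
`orbit_subset_box82_of_condI`, the anchor cube being the tag's `zZ.1 ∈ zZ.2`). [folklore] -/
theorem MDP_subset_three (hL : 2 ≤ L) (hdrop : ∀ m, DropCtl s m) :
    ∀ (P : PGen (Pt d × Finset (Pt d))) (Z : Finset (Pt d)), RealisesW L s R P Z → ∀ (m : ℕ),
      MDP L s P m ⊆ (youngSet L s P m ∪ freshSet L s P m) ∪ (oldAnchors L s P m).biUnion fun a => box a 82
  | .birth j cls zZ, Z, hP, m => by
      obtain ⟨hZ, hc, -, -⟩ := hP
      have hcZ : zZ.1 ∈ zZ.2 := by rw [hZ]; exact hc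
      intro y hy
      unfold MDP at hy
      by_cases hj : j ≤ m
      · rw [if_pos hj] at hy
        rw [Finset.mem_union, Finset.mem_union]
        by_cases hyoung : ∀ i, i ≤ m - j → ¬ CondI 100 (orbit L s j zZ.2 i)
        · left; left; unfold youngSet; rw [if_pos ⟨hj, hyoung⟩]; exact hy
        · push Not at hyoung
          obtain ⟨i₀, hi₀, hI₀⟩ := hyoung
          by_cases hold : ∃ i, i + 14 ≤ m - j ∧ CondI 100 (orbit L s j zZ.2 i)
          · right
            obtain ⟨i, hi, hI⟩ := hold
            unfold oldAnchors
            rw [if_pos ⟨hj, i, hi, hI⟩, Finset.singleton_biUnion]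
            exact orbit_subset_box82_of_condI hL hdrop hcZ hI hi hy
          · left; right
            unfold freshSet
            rw [if_pos ⟨⟨hj, i₀, hi₀, hI₀⟩, hold⟩]
            exact hy
      · rw [if_neg hj] at hy; simp at hy
  | .renew G h, Z, hP, m => by
      obtain ⟨ZG, hG, -⟩ := hP
      exact MDP_subset_three hL hdrop G ZG hG m
  | .join X Y sj, Z, hP, m => by
      obtain ⟨ZX, ZY, hX, hY, -⟩ := hP
      have h1 := MDP_subset_three hL hdrop X ZX hX m
      have h2 := MDP_subset_three hL hdrop Y ZY hY m
      rw [MDP_join, youngSet_join, freshSet_join, oldAnchors_join, Finset.union_biUnion]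
      intro y hy
      simp only [Finset.mem_union] at hy ⊢
      rcases hy with hy | hy
      · have := h1 hy
        simp only [Finset.mem_union] at this
        tauto
      · have := h2 hy
        simp only [Finset.mem_union] at this
        tauto

/-- **THE THREE-WAY COUNT**: `#MDP P m ≤ youngVol P m + 561^d·nfresh P m + #(⋃_{a ∈ oldAnchors P m} box a 82)`.
[folklore] -/
theorem card_MDP_le_three (hL : 2 ≤ L) (hdrop : ∀ m, DropCtl s m) {P : PGen (Pt d × Finset (Pt d))}
    {Z : Finset (Pt d)} (hP : RealisesW L s R P Z) (m : ℕ) :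
    ((MDP L s P m).card : ℝ) ≤ youngVol L s P m + 561 ^ d * (nfresh L s P m : ℝ)
      + (((oldAnchors L s P m).biUnion fun a => box a 82).card : ℝ) := by
  have h1 := Finset.card_le_card (MDP_subset_three hL hdrop P Z hP m)
  have h2 := Finset.card_union_le (youngSet L s P m ∪ freshSet L s P m)
    ((oldAnchors L s P m).biUnion fun a => box a 82)
  have h3 := Finset.card_union_le (youngSet L s P m) (freshSet L s P m)
  have h4 : ((MDP L s P m).card : ℝ) ≤ (youngSet L s P m).card + (freshSet L s P m).card
      + (((oldAnchors L s P m).biUnion fun a => box a 82).card : ℝ) := by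
    exact_mod_cast h1.trans (h2.trans (Nat.add_le_add_right h3 _))
  linarith [card_youngSet_le (L := L) (s := s) P m, card_freshSet_le hL hdrop P Z hP m]

end Cover

/-! ## §3 The lagged thickened count of the old-dead boxes -/

section Transport

variable {L : ℕ} {s R : ℕ → ℕ}

/-- the thickened-footprint coefficient of the ledger at lag `i` is nonnegative [folklore] -/
theorem thick_nonneg (d i : ℕ) (v : ℕ) : (0 : ℝ) ≤ collar82 d + feed82 d * (v : ℝ) / 2 ^ i := by
  have := collar82_pos d; have := feed82_nonneg d; positivity

/-- the single-component case: for `lastStep ≤ t` and `t + 1 ≤ m` the old anchors lie in the lag-time footprint (A3b's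
transport via `oldAnchors ⊆ deadAnchors`), whose `82`-thickening E2 counts (the maximal domain at `t` is non-empty and
touch-connected, A3a). [folklore] -/
theorem tsingle (hL : 4 ≤ L) (hdrop : ∀ m, DropCtl s m) {P : PGen (Pt d × Finset (Pt d))} {Z : Finset (Pt d)}
    (hP : RealisesW L s R P Z) {t m : ℕ} (ht : P.lastStep ≤ t) (htm : t + 1 ≤ m) :
    (((oldAnchors L s P m).biUnion fun a => box a 82).card : ℝ) ≤
      compSum L s (fun v => collar82 d + feed82 d * (v : ℝ) / 2 ^ (m - t)) P t + 165 ^ d * (recent P t m : ℝ) := by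
  have hsub := ((oldAnchors_subset_deadAnchors P m).trans
    (deadAnchors_subset_closureIdx P Z hP (t := t) (m := m) ht (by omega)))
  have hne := nonempty_touchConnected_MDP (show 1 ≤ L by omega) P Z hP ht
  have hthick := card_thick82_closureIdx_le hL hdrop hne.1 hne.2 t (i := m - t) (by omega)
  have h1 : (((oldAnchors L s P m).biUnion fun a => box a 82).card : ℝ) ≤
      (((closureIdx (Qfrom L s t (m - t)) (MDP L s P t)).biUnion fun a => box a 82).card : ℝ) := by
    exact_mod_cast Finset.card_le_card (Finset.biUnion_subset_biUnion_of_subset_left _ hsub)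
  rw [compSum_of_le P (adm_of_realisesW P Z hP le_rfl) ht]
  have h3 : (0 : ℝ) ≤ 165 ^ d * (recent P t m : ℝ) := by positivity
  linarith

/-- **THE LAGGED THICKENED COUNT OF THE OLD-DEAD BOXES.**  For a pedigree realised along a flow with `L ≥ 4` and drop
control on every horizon, every `m` and every lag time `t` with `t + 1 ≤ m`:
`#(⋃_{a ∈ oldAnchors P m} box a 82) ≤ Σ_{components x at t} (collar82 d + feed82 d·#MDP_x(t)∕2^{m−t}) + 165^d·#{births in (t, m]}`.
[folklore] -/
theorem card_oldBox_le (hL : 4 ≤ L) (hdrop : ∀ m, DropCtl s m) :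
    ∀ (P : PGen (Pt d × Finset (Pt d))) (Z : Finset (Pt d)), RealisesW L s R P Z → ∀ {t m : ℕ}, t + 1 ≤ m →
      (((oldAnchors L s P m).biUnion fun a => box a 82).card : ℝ) ≤
        compSum L s (fun v => collar82 d + feed82 d * (v : ℝ) / 2 ^ (m - t)) P t + 165 ^ d * (recent P t m : ℝ)
  | .birth j cls zZ, Z, hP, t, m, htm => by
      by_cases hjt : j ≤ t
      · exact tsingle hL hdrop hP hjt htm
      · -- born after `t`: at most one radius-`82` box, counted as recent (or none if not yet born)
        have h0 : compSum L s (fun v => collar82 d + feed82 d * (v : ℝ) / 2 ^ (m - t)) (PGen.birth j cls zZ) t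
            = 0 := by unfold compSum; rw [if_neg hjt]
        rw [h0, zero_add]
        have hbox := card_biUnion_box82_le (d := d) (oldAnchors L s (PGen.birth j cls zZ) m)
        by_cases hjm : j ≤ m
        · have hr : recent (PGen.birth j cls zZ) t m = 1 := by
            unfold recent; rw [if_pos ⟨by omega, hjm⟩]
          have hd : (oldAnchors L s (PGen.birth j cls zZ) m).card ≤ 1 := by
            unfold oldAnchors; split_ifs <;> simp
          rw [hr, Nat.cast_one, mul_one]
          have hd' : ((oldAnchors L s (PGen.birth j cls zZ) m).card : ℝ) ≤ 1 := by exact_mod_cast hd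
          have h5 : (0 : ℝ) ≤ 165 ^ d := by positivity
          exact hbox.trans (mul_le_of_le_one_right h5 hd')
        · have hd : oldAnchors L s (PGen.birth j cls zZ) m = ∅ := by
            unfold oldAnchors; rw [if_neg (fun h => hjm h.1)]
          rw [hd]; simp
  | .renew G h, Z, hP, t, m, htm => by
      obtain ⟨ZG, hG, -⟩ := hP
      exact card_oldBox_le hL hdrop G ZG hG htm
  | .join X Y sj, Z, hP, t, m, htm => by
      by_cases hst : sj ≤ t
      · exact tsingle hL hdrop hP hst htm
      · obtain ⟨ZX, ZY, hX, hY, -⟩ := hP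
        have h1 := card_oldBox_le hL hdrop X ZX hX htm
        have h2 := card_oldBox_le hL hdrop Y ZY hY htm
        have h0 : compSum L s (fun v => collar82 d + feed82 d * (v : ℝ) / 2 ^ (m - t)) (PGen.join X Y sj) t
            = compSum L s (fun v => collar82 d + feed82 d * (v : ℝ) / 2 ^ (m - t)) X t
              + compSum L s (fun v => collar82 d + feed82 d * (v : ℝ) / 2 ^ (m - t)) Y t := by
          conv_lhs => unfold compSum
          rw [if_neg hst]
        have hu : (((oldAnchors L s (PGen.join X Y sj) m).biUnion fun a => box a 82).card : ℝ) ≤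
            (((oldAnchors L s X m).biUnion fun a => box a 82).card : ℝ)
              + (((oldAnchors L s Y m).biUnion fun a => box a 82).card : ℝ) := by
          rw [oldAnchors_join, Finset.union_biUnion]; exact_mod_cast Finset.card_union_le _ _
        have hr : (recent (PGen.join X Y sj) t m : ℝ) = recent X t m + recent Y t m := by
          rw [recent_join]; push_cast; ring
        rw [h0, hr]
        linarith

end Transport

/-! ## §4 The per-step inequality of the per-level dead box along a pedigree -/

section PerStep

variable {L : ℕ} {s R : ℕ → ℕ}

/-- the single-component case of the per-step inequality (`lastStep ≤ m`). [folklore] -/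
theorem psingle82 (hL : 4 ≤ L) (hdrop : ∀ m, DropCtl s m) {P : PGen (Pt d × Finset (Pt d))} {Z : Finset (Pt d)}
    (hP : RealisesW L s R P Z) {t m : ℕ} (hm : P.lastStep ≤ m) (htm : t + 1 ≤ m) :
    compSum L s (fun v => (v : ℝ)) P m ≤ youngVol L s P m + 561 ^ d * (nfresh L s P m : ℝ)
      + (compSum L s (fun v => collar82 d + feed82 d * (v : ℝ) / 2 ^ (m - t)) P t + 165 ^ d * (recent P t m : ℝ)) := by
  have h1 := card_MDP_le_three (show 2 ≤ L by omega) hdrop hP m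
  have h2 := card_oldBox_le hL hdrop P Z hP htm
  rw [compSum_of_le P (adm_of_realisesW P Z hP le_rfl) hm]
  linarith

/-- **THE PER-STEP INEQUALITY OF THE PER-LEVEL DEAD BOX** (ruling R-OWNER-51-1 (3)) for a pedigree realised along a flow
with `L ≥ 4` and drop control on every horizon, at every step `m` and lag time `t` with `t + 1 ≤ m`:
`V(m) ≤ Y(m) + 561^d·nfresh(m) + Σ_{components x at t} (collar82 d + feed82 d·V_x(t)∕2^{m−t}) + 165^d·#{births in (t, m]}`,
with `V = compSum id`, `Y = youngVol`. [folklore] -/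
theorem perStep82 (hL : 4 ≤ L) (hdrop : ∀ m, DropCtl s m) :
    ∀ (P : PGen (Pt d × Finset (Pt d))) (Z : Finset (Pt d)), RealisesW L s R P Z → ∀ {t m : ℕ}, t + 1 ≤ m →
      compSum L s (fun v => (v : ℝ)) P m ≤ youngVol L s P m + 561 ^ d * (nfresh L s P m : ℝ)
        + (compSum L s (fun v => collar82 d + feed82 d * (v : ℝ) / 2 ^ (m - t)) P t + 165 ^ d * (recent P t m : ℝ))
  | .birth j cls zZ, Z, hP, t, m, htm => by
      by_cases hjm : j ≤ m
      · exact psingle82 hL hdrop hP hjm htm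
      · have h0 : compSum L s (fun v => (v : ℝ)) (PGen.birth j cls zZ) m = 0 := by unfold compSum; rw [if_neg hjm]
        rw [h0]
        have := youngVol_nonneg (L := L) (s := s) (PGen.birth j cls zZ) m
        have := compSum_nonneg (L := L) (s := s) (thick_nonneg d (m - t)) (PGen.birth j cls zZ) t
        positivity
  | .renew G h, Z, hP, t, m, htm => by
      obtain ⟨ZG, hG, -⟩ := hP
      exact perStep82 hL hdrop G ZG hG htm
  | .join X Y sj, Z, hP, t, m, htm => by
      by_cases hsm : sj ≤ m
      · exact psingle82 hL hdrop hP hsm htm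
      · obtain ⟨ZX, ZY, hX, hY, -⟩ := hP
        have h1 := perStep82 hL hdrop X ZX hX htm
        have h2 := perStep82 hL hdrop Y ZY hY htm
        have hst : ¬ sj ≤ t := fun h => hsm (by omega)
        have h0 : compSum L s (fun v => (v : ℝ)) (PGen.join X Y sj) m =
            compSum L s (fun v => (v : ℝ)) X m + compSum L s (fun v => (v : ℝ)) Y m := by
          conv_lhs => unfold compSum
          rw [if_neg hsm]
        have h0' : compSum L s (fun v => collar82 d + feed82 d * (v : ℝ) / 2 ^ (m - t)) (PGen.join X Y sj) t
            = compSum L s (fun v => collar82 d + feed82 d * (v : ℝ) / 2 ^ (m - t)) X t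
              + compSum L s (fun v => collar82 d + feed82 d * (v : ℝ) / 2 ^ (m - t)) Y t := by
          conv_lhs => unfold compSum
          rw [if_neg hst]
        have hy : youngVol L s (PGen.join X Y sj) m = youngVol L s X m + youngVol L s Y m := youngVol_join _ _ _ _
        have hr : (recent (PGen.join X Y sj) t m : ℝ) = recent X t m + recent Y t m := by
          rw [recent_join]; push_cast; ring
        have hf : (nfresh L s (PGen.join X Y sj) m : ℝ) = nfresh L s X m + nfresh L s Y m := by
          rw [nfresh_join]; push_cast; ring
        rw [h0, h0', hy, hr, hf]
        linarith

end PerStep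


end

end Summit.QuantumFields.BalabanUV.T4Continuum.HistoryBankingPedigreeLedger82
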